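import Mathlib
import Summits.Ventures.HodgeRepro.CMType
import Summits.Ventures.HodgeRepro.HodgeSets
import Summits.Ventures.HodgeRepro.CMRank
import Summits.Ventures.HodgeRepro.MuTable

/-!
# Antipodal pairs in the μ-table (blind cell `pub-hodge-repro`, seat p2)

Two characters `x_s`, `x_t` are *antipodal* if their weights (columns of the μ-table) add up to the
all-ones vector: `w_s + w_t = 1`.  Examples: `t = c s` (complex conjugation, `weight_conj`).  An
antipodal pair `{s, t}` is a Hodge set of size `2` (a `(1,1)`-class), and removing an antipodal pair
from a Hodge set leaves a Hodge set.  Consequently a CM type in which every nonempty Hodge set contains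
an antipodal pair has all its Hodge sets equal to disjoint unions of antipodal pairs — all its Hodge
classes are products of `(1,1)`-classes, hence algebraic by Lefschetz `(1,1)`.  (For a nondegenerate
type this is White's observation, Gordon §9.2.2/9.3; `MuPairsRank.lean` proves the hypothesis from
`cmRank Φ = [G : rstab Φ]/2 + 1`, which covers every rank-`4` type of the degree-`6/8/12` census.)
-/

open Finset
open scoped Pointwise

namespace HodgeRepro

variable {G : Type*} [Group G] [DecidableEq G] [Fintype G]

/-- `s` and `t` are antipodal: their weights add up to the all-ones vector. -/
def IsAntipodal (Φ : Finset G) (s t : G) : Prop := weight Φ s + weight Φ t = 1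

omit [Fintype G] in
/-- Antipodality is symmetric. -/
theorem isAntipodal_comm {Φ : Finset G} {s t : G} (h : IsAntipodal Φ s t) : IsAntipodal Φ t s := by
  unfold IsAntipodal at *
  rw [add_comm]
  exact h

/-- `s` and `c s` are antipodal (Deligne Ex. 3.7 (d)). -/
theorem isAntipodal_conj {c : G} {Φ : Finset G} (hc : IsComplexConj c) (hΦ : IsCMType c Φ) (s : G) :
    IsAntipodal Φ s (c * s) := by
  unfold IsAntipodal
  rw [weight_conj hc hΦ]
  abel

omit [Fintype G] in
/-- Antipodal characters are distinct (a `0/1` vector is never its own antipode). -/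
theorem IsAntipodal.ne {Φ : Finset G} {s t : G} (h : IsAntipodal Φ s t) : s ≠ t := by
  rintro rfl
  have h1 := congrFun h 1
  simp only [Pi.add_apply, Pi.one_apply, weight_apply] at h1
  split_ifs at h1 <;> norm_num at h1

omit [Fintype G] in
/-- The weights of antipodal characters are read off each other. -/
theorem IsAntipodal.weight_eq {Φ : Finset G} {s t : G} (h : IsAntipodal Φ s t) :
    weight Φ t = 1 - weight Φ s := by
  unfold IsAntipodal at h
  rw [← h]
  abel

/-- An antipodal pair is a Hodge set of size `2`. -/
theorem isHodgeSet_pair_of_isAntipodal {c : G} {Φ : Finset G} (hc : IsComplexConj c)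
    (hΦ : IsCMType c Φ) {s t : G} (h : IsAntipodal Φ s t) : IsHodgeSet c Φ {s, t} := by
  rw [isHodgeSet_iff_sum_weight hc hΦ _ 1 (by rw [card_pair h.ne])]
  rw [sum_pair h.ne]
  ext g
  have := congrFun h g
  simpa using this

/-- Removing an antipodal pair from a Hodge set leaves a Hodge set. -/
theorem IsHodgeSet.sdiff_pair {c : G} {Φ : Finset G} (hc : IsComplexConj c) (hΦ : IsCMType c Φ)
    {Δ : Finset G} (hΔ : IsHodgeSet c Φ Δ) {s t : G} (hs : s ∈ Δ) (ht : t ∈ Δ)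
    (h : IsAntipodal Φ s t) : IsHodgeSet c Φ (Δ \ {s, t}) := by
  have hsub : {s, t} ⊆ Δ := by
    intro x hx
    simp only [mem_insert, mem_singleton] at hx
    rcases hx with rfl | rfl <;> assumption
  obtain ⟨p, hp⟩ := (hΔ.even_card hc hΦ)
  have hcard : Δ.card = 2 * p := by omega
  have hp1 : 1 ≤ p := by
    have := card_le_card hsub
    rw [card_pair h.ne] at this
    omega
  have hsum := (isHodgeSet_iff_sum_weight hc hΦ Δ p hcard).1 hΔ
  have hcard' : (Δ \ {s, t}).card = 2 * (p - 1) := by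
    rw [card_sdiff_of_subset hsub, card_pair h.ne, hcard]
    omega
  rw [isHodgeSet_iff_sum_weight hc hΦ _ (p - 1) hcard']
  have hsplit := sum_sdiff (f := weight Φ) hsub
  rw [hsum, sum_pair h.ne] at hsplit
  ext g
  have h1 := congrFun hsplit g
  have h2 := congrFun h g
  simp only [Finset.sum_apply, Pi.add_apply, Pi.one_apply] at h1 h2 ⊢
  have hp' : ((p - 1 : ℕ) : ℚ) = (p : ℚ) - 1 := by
    rw [Nat.cast_sub hp1, Nat.cast_one]
  rw [hp']
  linarith

/-- `Δ` is a disjoint union of antipodal pairs. -/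
inductive IsPairUnion (Φ : Finset G) : Finset G → Prop
  | empty : IsPairUnion Φ ∅
  | insert_pair {Δ : Finset G} {s t : G} : IsAntipodal Φ s t → s ∉ Δ → t ∉ Δ → IsPairUnion Φ Δ →
      IsPairUnion Φ (insert s (insert t Δ))

/-- A disjoint union of antipodal pairs is a Hodge set. -/
theorem IsPairUnion.isHodgeSet {c : G} {Φ : Finset G} (hc : IsComplexConj c) (hΦ : IsCMType c Φ)
    {Δ : Finset G} (h : IsPairUnion Φ Δ) : IsHodgeSet c Φ Δ := by
  induction h with
  | empty => exact isHodgeSet_empty c Φ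
  | @insert_pair Δ s t hst hs ht _ ih =>
    have hpair : IsHodgeSet c Φ {s, t} := isHodgeSet_pair_of_isAntipodal hc hΦ hst
    have hdisj : Disjoint ({s, t} : Finset G) Δ := by
      rw [disjoint_insert_left, disjoint_singleton_left]
      exact ⟨hs, ht⟩
    have := IsHodgeSet.union hc hΦ hpair ih hdisj
    rwa [insert_union, singleton_union] at this

omit [Fintype G] in
/-- A disjoint union of antipodal pairs has even cardinality, twice the number of pairs. -/
theorem IsPairUnion.even_card {Φ : Finset G} {Δ : Finset G} (h : IsPairUnion Φ Δ) : Even Δ.card := by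
  induction h with
  | empty => simp
  | @insert_pair Δ s t hst hs ht _ ih =>
    rw [card_insert_of_notMem, card_insert_of_notMem ht]
    · obtain ⟨k, hk⟩ := ih
      exact ⟨k + 1, by omega⟩
    · simp only [mem_insert, not_or]
      exact ⟨hst.ne, hs⟩

/-- Descent: if every nonempty Hodge set contains an antipodal pair, then every Hodge set is a
disjoint union of antipodal pairs. -/
theorem isPairUnion_of_forall_exists_antipodal {c : G} {Φ : Finset G} (hc : IsComplexConj c)
    (hΦ : IsCMType c Φ)
    (H : ∀ Δ : Finset G, IsHodgeSet c Φ Δ → Δ.Nonempty → ∃ s ∈ Δ, ∃ t ∈ Δ, IsAntipodal Φ s t) :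
    ∀ Δ : Finset G, IsHodgeSet c Φ Δ → IsPairUnion Φ Δ := by
  intro Δ
  induction Δ using Finset.strongInduction with
  | H Δ ih =>
    intro hΔ
    rcases Δ.eq_empty_or_nonempty with rfl | hne
    · exact IsPairUnion.empty
    · obtain ⟨s, hs, t, ht, hst⟩ := H Δ hΔ hne
      have hsub : {s, t} ⊆ Δ := by
        intro x hx
        simp only [mem_insert, mem_singleton] at hx
        rcases hx with rfl | rfl <;> assumption
      have hlt : Δ \ {s, t} ⊂ Δ := by
        rw [Finset.ssubset_iff_subset_ne]
        refine ⟨sdiff_subset, ?_⟩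
        intro heq
        have : s ∈ Δ \ {s, t} := by rw [heq]; exact hs
        simp at this
      have hrest := ih _ hlt (hΔ.sdiff_pair hc hΦ hs ht hst)
      have hΔeq : Δ = insert s (insert t (Δ \ {s, t})) := by
        ext x
        simp only [mem_insert, mem_sdiff, mem_singleton]
        constructor
        · intro hx
          by_cases h1 : x = s
          · exact Or.inl h1
          · by_cases h2 : x = t
            · exact Or.inr (Or.inl h2)
            · exact Or.inr (Or.inr ⟨hx, by tauto⟩)
        · rintro (rfl | rfl | ⟨hx, _⟩) <;> assumption
      rw [hΔeq]
      exact IsPairUnion.insert_pair hst (by simp) (by simp) hrest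

end HodgeRepro
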